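import Literature.AlgebraicGeometry.HodgeTheory.CyclicCoverTotalSpacePoints
import Literature.AlgebraicGeometry.HodgeTheory.HyperplaneSectionMonodromyTrivialisations
import HarnessLib

/-!
# Scaling the cover coordinate: continuous maps between the fibres of the Carlson–Toledo family
# (the isotopies `x₃ ↦ μ x₃` covering the scalar action `f ↦ μ^p f` on ternary forms; CT99 §2)

Family `hodge`, layer `Literature/AlgebraicGeometry/HodgeTheory`. Written by the prover seat `hodge-nonav-prover-Bx`
(g8) for the route `CyclicUnitaryPowers` of the Hodge summit: the fibrewise isotopies of the universal family
`u = cyclicCoverFamily p : 𝒴 ⟶ S` of smooth `p`-cyclic covers `x₃^p = f` ("`y ↦ ζ y`" of [CarlsonToledo1999] §2,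
interpolated), used with `DirectImageIsotopy` to identify the deck transformation as the monodromy of the scalar loop.

Data: the homogeneous coordinates `Θ = ([z], u) : 𝒴(ℂ) ≅ {([z], t) | F_t(z) = 0}`
(`CyclicCoverTotalSpacePoints.isClosedEmbedding_coords_prod_map`) and the topological fibres
`X_t(ℂ) ≃ₜ u(ℂ)⁻¹(t)` (`fiberHomeomorph`).

* `scaleProj a` — the projectivity `[z] ↦ [a * z]` of `ℙ(ℂ⁴)` for `a ∈ (ℂˣ)⁴` (Mathlib `Projectivization.map`),
  `scaleProj_mk`, jointly continuous in `(a, [z])` (`continuous_scaleProj_uncurry`: `ℂ⁴ ∖ 0 → ℙ(ℂ⁴)` is an open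
  quotient map, `Projectivization.isOpenQuotientMap_mk`).
* `fibreScale t₁ t₂ a h` — **the continuous map `X_{t₁}(ℂ) → X_{t₂}(ℂ)`, `[z] ↦ [a * z]`**, defined when the
  projectivity carries `V(F_{t₁})` into `V(F_{t₂})`; its coordinates (`coords_fibreScale`, `map_fibreScale`),
  composition (`fibreScale_comp_apply`), identity (`fibreScale_one_apply`), and the JOINT continuity of
  `(Q, u) ↦ ι(fibreScale t₁ (t u) (a u) Q)` in `𝒴(ℂ)` for continuous `t(u)`, `a(u)` (`continuous_fibreScale_family`).

## References

* [CarlsonToledo1999] J. A. Carlson, D. Toledo, Duke Math. J. 97 (1999), §2 (the cyclic action `y ↦ ζ y` on the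
  universal family (universalcyclic); held text p0004–p0005).
* [SerreGAGA1956] J.-P. Serre, GAGA, §2 n°5.
-/

noncomputable section

namespace Literature.AlgebraicGeometry.HodgeTheory

open CategoryTheory _root_.AlgebraicGeometry _root_.Topology
open scoped LinearAlgebra.Projectivization
open Literature.AlgebraicGeometry.Motives Literature.AlgebraicGeometry.Motives.UniversalHypersurface
open Literature.AlgebraicGeometry.HodgeTheory.UniversalHypersurface
open Literature.NumberTheory.Transcendental

/-! ### The projectivities `[z] ↦ [a * z]` -/

section Scale

/-- `v ↦ a * v` is injective on `ℂ⁴` when no entry of `a` vanishes. [cite: CarlsonToledo1999, §2 (held text p0004–p0005)] -/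
theorem mulLeft_injective_of_ne_zero {a : Fin 4 → ℂ} (ha : ∀ i, a i ≠ 0) :
    Function.Injective (LinearMap.mulLeft ℂ a) := fun v w h =>
  funext fun i => mul_left_cancel₀ (ha i) (by simpa using congrFun h i)

/-- The **scaling projectivity** `[z] ↦ [a * z]` of `ℙ(ℂ⁴)` (e.g. `a = (1, 1, 1, μ)`: "`y ↦ μ y`" on the cover
coordinate). [cite: CarlsonToledo1999, §2 (held text p0004–p0005)] -/
def scaleProj (a : Fin 4 → ℂ) (ha : ∀ i, a i ≠ 0) : ℙ ℂ (Fin 4 → ℂ) → ℙ ℂ (Fin 4 → ℂ) :=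
  Projectivization.map (LinearMap.mulLeft ℂ a) (mulLeft_injective_of_ne_zero ha)

/-- `a * v ≠ 0` for `v ≠ 0`. [cite: CarlsonToledo1999, §2 (held text p0004–p0005)] -/
theorem mul_ne_zero_of_ne_zero {a : Fin 4 → ℂ} (ha : ∀ i, a i ≠ 0) {v : Fin 4 → ℂ} (hv : v ≠ 0) :
    a * v ≠ 0 := fun h =>
  hv (mulLeft_injective_of_ne_zero ha (by simpa using h))

/-- `scaleProj a [v] = [a * v]`. [cite: CarlsonToledo1999, §2 (held text p0004–p0005)] -/
theorem scaleProj_mk {a : Fin 4 → ℂ} (ha : ∀ i, a i ≠ 0) (v : Fin 4 → ℂ) (hv : v ≠ 0) :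
    scaleProj a ha (Projectivization.mk ℂ v hv) = Projectivization.mk ℂ (a * v) (mul_ne_zero_of_ne_zero ha hv) :=
  Projectivization.map_mk _ _ v hv

/-- **Joint continuity of `(a, [z]) ↦ [a * z]`** on `{a | ∀ i, aᵢ ≠ 0} × ℙ(ℂ⁴)`: the product of the identity
with the open quotient map `ℂ⁴ ∖ 0 → ℙ(ℂ⁴)` is a quotient map. [cite: GriffithsHarrisPrinciples1978, Ch. 0 §2 p. 15] -/
theorem continuous_scaleProj_uncurry :
    Continuous fun q : {a : Fin 4 → ℂ // ∀ i, a i ≠ 0} × ℙ ℂ (Fin 4 → ℂ) => scaleProj q.1.1 q.1.2 q.2 := by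
  have hq : IsOpenQuotientMap (Prod.map (id : {a : Fin 4 → ℂ // ∀ i, a i ≠ 0} → _)
      (fun v : {v : Fin 4 → ℂ // v ≠ 0} => Projectivization.mk ℂ v.1 v.2)) :=
    IsOpenQuotientMap.id.prodMap Projectivization.isOpenQuotientMap_mk
  rw [hq.isQuotientMap.continuous_iff]
  have heq : ((fun q : {a : Fin 4 → ℂ // ∀ i, a i ≠ 0} × ℙ ℂ (Fin 4 → ℂ) => scaleProj q.1.1 q.1.2 q.2) ∘
      Prod.map id (fun v : {v : Fin 4 → ℂ // v ≠ 0} => Projectivization.mk ℂ v.1 v.2)) =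
      fun q : {a : Fin 4 → ℂ // ∀ i, a i ≠ 0} × {v : Fin 4 → ℂ // v ≠ 0} =>
        Projectivization.mk ℂ (q.1.1 * q.2.1) (mul_ne_zero_of_ne_zero q.1.2 q.2.2) := by
    funext q
    exact scaleProj_mk q.1.2 q.2.1 q.2.2
  rw [heq]
  have h1 : Continuous fun q : {a : Fin 4 → ℂ // ∀ i, a i ≠ 0} × {v : Fin 4 → ℂ // v ≠ 0} =>
      (⟨q.1.1 * q.2.1, mul_ne_zero_of_ne_zero q.1.2 q.2.2⟩ : {v : Fin 4 → ℂ // v ≠ 0}) :=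
    ((continuous_subtype_val.comp continuous_fst).mul (continuous_subtype_val.comp continuous_snd)).subtype_mk _
  exact Projectivization.continuous_mk.comp h1

/-- `scaleProj a` is continuous. [cite: GriffithsHarrisPrinciples1978, Ch. 0 §2 p. 15] -/
theorem continuous_scaleProj {a : Fin 4 → ℂ} (ha : ∀ i, a i ≠ 0) : Continuous (scaleProj a ha) :=
  continuous_scaleProj_uncurry.comp (Continuous.prodMk_right (⟨a, ha⟩ : {a : Fin 4 → ℂ // ∀ i, a i ≠ 0}))

/-- `[b * (a * z)] = [(b * a) * z]`. [cite: GriffithsHarrisPrinciples1978, Ch. 0 §2 p. 15] -/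
theorem scaleProj_scaleProj {a b : Fin 4 → ℂ} (ha : ∀ i, a i ≠ 0) (hb : ∀ i, b i ≠ 0) (ℓ : ℙ ℂ (Fin 4 → ℂ)) :
    scaleProj b hb (scaleProj a ha ℓ) = scaleProj (b * a) (fun i => mul_ne_zero (hb i) (ha i)) ℓ := by
  induction ℓ using Projectivization.ind with
  | h v hv => rw [scaleProj_mk, scaleProj_mk, scaleProj_mk]; congr 1; rw [mul_assoc]

/-- `[1 * z] = [z]`. [cite: GriffithsHarrisPrinciples1978, Ch. 0 §2 p. 15] -/
theorem scaleProj_one (ℓ : ℙ ℂ (Fin 4 → ℂ)) : scaleProj 1 (fun _ => one_ne_zero) ℓ = ℓ := by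
  induction ℓ using Projectivization.ind with
  | h v hv => rw [scaleProj_mk]; congr 1; rw [one_mul]

end Scale

/-! ### Scaled maps between the fibres -/

section Fibre

variable (p : ℕ) [NeZero p]

/-- The range of `Θ = ([z], u)` is the incidence set: `([z], t) ∈ Θ(𝒴(ℂ)) ↔ F_t(z) = 0`.
[cite: CarlsonToledo1999, §2 (universalcyclic) (held text p0004)] -/
theorem mem_range_coords_prod_map_iff (ℓ : ℙ ℂ (Fin 4 → ℂ)) (t : ComplexPoints (cyclicCoverBase p)) :
    (ℓ, t) ∈ Set.range (fun P : ComplexPoints (cyclicCoverTotal p) =>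
      (hypersurfacePoint (totalSpzToTotal ℂ 2 p (cyclicCoverSpz p) ≫
          UniversalHypersurface.toProjectiveSpace ℂ 2 p) P,
        AlgPoints.map (cyclicCoverFamily p) P)) ↔
      ℓ ∈ Projectivization.projZeroLocus {pointFormSpz ℂ 2 p (cyclicCoverSpz p) t} := by
  constructor
  · rintro ⟨P, hP⟩
    rw [Prod.mk.injEq] at hP
    obtain ⟨h1, h2⟩ := hP
    rw [← h1, ← h2]
    exact coords_mem_projZeroLocus p P
  · intro hℓ
    obtain ⟨P, hP, hc⟩ := exists_point_of_mem_projZeroLocus p t hℓ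
    exact ⟨P, Prod.ext hc hP⟩

variable {p}

/-- The total space is separated over `ℂ` (quasi-projective). [cite: CarlsonToledo1999, §2 (held text p0004)] -/
theorem isSeparated_cyclicCoverTotal_hom : IsSeparated (cyclicCoverTotal p).hom :=
  (isQuasiProjectiveOver_totalSpz 2 p (cyclicCoverSpz p)
    (cyclicCoverSpz_surjective p (NeZero.ne p))).isVarietyPair_ofScheme.isSeparated

/-- The family is proper. [cite: CarlsonToledo1999, §2 (held text p0004)] -/
theorem isProper_cyclicCoverFamily_left : IsProper (cyclicCoverFamily p).left :=
  (isSmoothProjectiveFamily_cyclicCoverFamily p).isProper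

/-- **The point of `𝒴(ℂ)` over `t` with coordinates `[a * z]`** (through `Θ⁻¹`), for `[z] ∈ ℙ(ℂ⁴)` with
`[a * z] ∈ V(F_t)`. [cite: CarlsonToledo1999, §2 (universalcyclic) (held text p0004–p0005)] -/
def scaledTotalPoint (t : ComplexPoints (cyclicCoverBase p)) (a : Fin 4 → ℂ) (ha : ∀ i, a i ≠ 0)
    (ℓ : ℙ ℂ (Fin 4 → ℂ))
    (hℓ : scaleProj a ha ℓ ∈ Projectivization.projZeroLocus {pointFormSpz ℂ 2 p (cyclicCoverSpz p) t}) :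
    ComplexPoints (cyclicCoverTotal p) :=
  (isClosedEmbedding_coords_prod_map p).isEmbedding.toHomeomorph.symm
    ⟨(scaleProj a ha ℓ, t), (mem_range_coords_prod_map_iff p _ t).mpr hℓ⟩

/-- `Θ (scaledTotalPoint t a [z]) = ([a * z], t)`. [cite: CarlsonToledo1999, §2 (held text p0004–p0005)] -/
theorem coords_prod_map_scaledTotalPoint (t : ComplexPoints (cyclicCoverBase p)) (a : Fin 4 → ℂ) (ha : ∀ i, a i ≠ 0)
    (ℓ : ℙ ℂ (Fin 4 → ℂ))
    (hℓ : scaleProj a ha ℓ ∈ Projectivization.projZeroLocus {pointFormSpz ℂ 2 p (cyclicCoverSpz p) t}) :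
    (hypersurfacePoint (totalSpzToTotal ℂ 2 p (cyclicCoverSpz p) ≫
          UniversalHypersurface.toProjectiveSpace ℂ 2 p) (scaledTotalPoint t a ha ℓ hℓ),
        AlgPoints.map (cyclicCoverFamily p) (scaledTotalPoint t a ha ℓ hℓ)) = (scaleProj a ha ℓ, t) :=
  congrArg Subtype.val ((isClosedEmbedding_coords_prod_map p).isEmbedding.toHomeomorph.apply_symm_apply
    ⟨(scaleProj a ha ℓ, t), (mem_range_coords_prod_map_iff p _ t).mpr hℓ⟩)

/-- The coordinates of `scaledTotalPoint t a [z]` are `[a * z]`. [cite: CarlsonToledo1999, §2 (held text p0004–p0005)] -/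
theorem coords_scaledTotalPoint (t : ComplexPoints (cyclicCoverBase p)) (a : Fin 4 → ℂ) (ha : ∀ i, a i ≠ 0)
    (ℓ : ℙ ℂ (Fin 4 → ℂ))
    (hℓ : scaleProj a ha ℓ ∈ Projectivization.projZeroLocus {pointFormSpz ℂ 2 p (cyclicCoverSpz p) t}) :
    hypersurfacePoint (totalSpzToTotal ℂ 2 p (cyclicCoverSpz p) ≫
        UniversalHypersurface.toProjectiveSpace ℂ 2 p) (scaledTotalPoint t a ha ℓ hℓ) = scaleProj a ha ℓ :=
  congrArg Prod.fst (coords_prod_map_scaledTotalPoint t a ha ℓ hℓ)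

/-- `scaledTotalPoint t a [z]` lies over `t`. [cite: CarlsonToledo1999, §2 (held text p0004–p0005)] -/
theorem map_scaledTotalPoint (t : ComplexPoints (cyclicCoverBase p)) (a : Fin 4 → ℂ) (ha : ∀ i, a i ≠ 0)
    (ℓ : ℙ ℂ (Fin 4 → ℂ))
    (hℓ : scaleProj a ha ℓ ∈ Projectivization.projZeroLocus {pointFormSpz ℂ 2 p (cyclicCoverSpz p) t}) :
    AlgPoints.map (cyclicCoverFamily p) (scaledTotalPoint t a ha ℓ hℓ) = t :=
  congrArg Prod.snd (coords_prod_map_scaledTotalPoint t a ha ℓ hℓ)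

/-- **Joint continuity of `scaledTotalPoint`** in `(a, [z], t)` (on the subtype where it is defined).
[cite: CarlsonToledo1999, §2 (held text p0004–p0005)] -/
theorem continuous_scaledTotalPoint {A : Type*} [TopologicalSpace A] (t : A → ComplexPoints (cyclicCoverBase p))
    (ht : Continuous t) (a : A → Fin 4 → ℂ) (ha : ∀ x i, a x i ≠ 0) (hac : Continuous a)
    (ℓ : A → ℙ ℂ (Fin 4 → ℂ)) (hℓc : Continuous ℓ)
    (hℓ : ∀ x, scaleProj (a x) (ha x) (ℓ x) ∈
      Projectivization.projZeroLocus {pointFormSpz ℂ 2 p (cyclicCoverSpz p) (t x)}) :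
    Continuous fun x => scaledTotalPoint (t x) (a x) (ha x) (ℓ x) (hℓ x) := by
  unfold scaledTotalPoint
  refine (isClosedEmbedding_coords_prod_map p).isEmbedding.toHomeomorph.symm.continuous.comp ?_
  refine Continuous.subtype_mk (Continuous.prodMk ?_ ht) _
  exact continuous_scaleProj_uncurry.comp ((hac.subtype_mk fun x => ha x).prodMk hℓc)

/-- The coordinates of a point of the fibre over `t₁` scale into `V(F_{t₂})` when the projectivity carries
`V(F_{t₁})` into `V(F_{t₂})`. [cite: CarlsonToledo1999, §2 (held text p0004–p0005)] -/
theorem scaleProj_coords_mem {t₁ t₂ : ComplexPoints (cyclicCoverBase p)} {a : Fin 4 → ℂ} (ha : ∀ i, a i ≠ 0)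
    (hland : ∀ ℓ ∈ Projectivization.projZeroLocus {pointFormSpz ℂ 2 p (cyclicCoverSpz p) t₁},
      scaleProj a ha ℓ ∈ Projectivization.projZeroLocus {pointFormSpz ℂ 2 p (cyclicCoverSpz p) t₂})
    (Q : ComplexPoints (fiberOver (cyclicCoverFamily p) t₁)) :
    scaleProj a ha (hypersurfacePoint (totalSpzToTotal ℂ 2 p (cyclicCoverSpz p) ≫
        UniversalHypersurface.toProjectiveSpace ℂ 2 p) (AlgPoints.map (fiberι (cyclicCoverFamily p) t₁) Q)) ∈
      Projectivization.projZeroLocus {pointFormSpz ℂ 2 p (cyclicCoverSpz p) t₂} := by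
  refine hland _ ?_
  have h := coords_mem_projZeroLocus p (AlgPoints.map (fiberι (cyclicCoverFamily p) t₁) Q)
  rwa [AlgPoints.map_map_fiberι] at h

/-- **The scaled map between two fibres**: for base points `t₁, t₂` and `a ∈ (ℂˣ)⁴` such that `[z] ↦ [a * z]`
carries `V(F_{t₁})` into `V(F_{t₂})`, the continuous map `X_{t₁}(ℂ) → X_{t₂}(ℂ)` sending the point with
coordinates `[z]` to the point with coordinates `[a * z]` (through `Θ⁻¹` and the topological fibre
`X_{t₂}(ℂ) ≃ₜ u(ℂ)⁻¹(t₂)`). [cite: CarlsonToledo1999, §2 (held text p0004–p0005)] -/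
def fibreScale (t₁ t₂ : ComplexPoints (cyclicCoverBase p)) (a : Fin 4 → ℂ) (ha : ∀ i, a i ≠ 0)
    (hland : ∀ ℓ ∈ Projectivization.projZeroLocus {pointFormSpz ℂ 2 p (cyclicCoverSpz p) t₁},
      scaleProj a ha ℓ ∈ Projectivization.projZeroLocus {pointFormSpz ℂ 2 p (cyclicCoverSpz p) t₂}) :
    C(ComplexPoints (fiberOver (cyclicCoverFamily p) t₁), ComplexPoints (fiberOver (cyclicCoverFamily p) t₂)) :=
  haveI : IsProper (cyclicCoverFamily p).left := isProper_cyclicCoverFamily_left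
  haveI : IsSeparated (cyclicCoverTotal p).hom := isSeparated_cyclicCoverTotal_hom
  ⟨fun Q => (fiberHomeomorph (cyclicCoverFamily p) t₂).symm
      ⟨scaledTotalPoint t₂ a ha _ (scaleProj_coords_mem ha hland Q),
        map_scaledTotalPoint t₂ a ha _ (scaleProj_coords_mem ha hland Q)⟩,
    (fiberHomeomorph (cyclicCoverFamily p) t₂).symm.continuous.comp
      ((continuous_scaledTotalPoint (fun _ => t₂) continuous_const (fun _ => a) (fun _ => ha) continuous_const
        _ ((continuous_hypersurfacePoint _).comp (AlgPoints.continuous_map _))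
        (scaleProj_coords_mem ha hland)).subtype_mk _)⟩

/-- **`fibreScale` on points of the total space**: `ι_{t₂}(fibreScale Q) = scaledTotalPoint t₂ a [z](ι_{t₁} Q)`.
[cite: CarlsonToledo1999, §2 (held text p0004–p0005)] -/
theorem map_fiberι_fibreScale {t₁ t₂ : ComplexPoints (cyclicCoverBase p)} {a : Fin 4 → ℂ} (ha : ∀ i, a i ≠ 0)
    (hland : ∀ ℓ ∈ Projectivization.projZeroLocus {pointFormSpz ℂ 2 p (cyclicCoverSpz p) t₁},
      scaleProj a ha ℓ ∈ Projectivization.projZeroLocus {pointFormSpz ℂ 2 p (cyclicCoverSpz p) t₂})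
    (Q : ComplexPoints (fiberOver (cyclicCoverFamily p) t₁)) :
    AlgPoints.map (fiberι (cyclicCoverFamily p) t₂) (fibreScale t₁ t₂ a ha hland Q) =
      scaledTotalPoint t₂ a ha _ (scaleProj_coords_mem ha hland Q) := by
  haveI : IsProper (cyclicCoverFamily p).left := isProper_cyclicCoverFamily_left
  haveI : IsSeparated (cyclicCoverTotal p).hom := isSeparated_cyclicCoverTotal_hom
  change AlgPoints.map (fiberι (cyclicCoverFamily p) t₂) ((fiberHomeomorph (cyclicCoverFamily p) t₂).symm _) = _
  rw [← coe_fiberHomeomorph_apply, Homeomorph.apply_symm_apply]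

/-- **Coordinates of `fibreScale`**: `[z](ι(fibreScale Q)) = [a * z(ι Q)]`. [cite: CarlsonToledo1999, §2 (held text p0004–p0005)] -/
theorem coords_map_fiberι_fibreScale {t₁ t₂ : ComplexPoints (cyclicCoverBase p)} {a : Fin 4 → ℂ}
    (ha : ∀ i, a i ≠ 0)
    (hland : ∀ ℓ ∈ Projectivization.projZeroLocus {pointFormSpz ℂ 2 p (cyclicCoverSpz p) t₁},
      scaleProj a ha ℓ ∈ Projectivization.projZeroLocus {pointFormSpz ℂ 2 p (cyclicCoverSpz p) t₂})
    (Q : ComplexPoints (fiberOver (cyclicCoverFamily p) t₁)) :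
    hypersurfacePoint (totalSpzToTotal ℂ 2 p (cyclicCoverSpz p) ≫ UniversalHypersurface.toProjectiveSpace ℂ 2 p)
        (AlgPoints.map (fiberι (cyclicCoverFamily p) t₂) (fibreScale t₁ t₂ a ha hland Q)) =
      scaleProj a ha (hypersurfacePoint (totalSpzToTotal ℂ 2 p (cyclicCoverSpz p) ≫
        UniversalHypersurface.toProjectiveSpace ℂ 2 p) (AlgPoints.map (fiberι (cyclicCoverFamily p) t₁) Q)) := by
  rw [map_fiberι_fibreScale, coords_scaledTotalPoint]

/-- **A point of the fibre is determined by its coordinates**: two points of `X_t(ℂ)` with the same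
`[z](ι ·)` are equal. [cite: SerreGAGA1956, §2 n°5 Lemme 1 b)] -/
theorem eq_of_coords_map_fiberι_eq {t : ComplexPoints (cyclicCoverBase p)}
    {Q Q' : ComplexPoints (fiberOver (cyclicCoverFamily p) t)}
    (h : hypersurfacePoint (totalSpzToTotal ℂ 2 p (cyclicCoverSpz p) ≫ UniversalHypersurface.toProjectiveSpace ℂ 2 p)
        (AlgPoints.map (fiberι (cyclicCoverFamily p) t) Q) =
      hypersurfacePoint (totalSpzToTotal ℂ 2 p (cyclicCoverSpz p) ≫ UniversalHypersurface.toProjectiveSpace ℂ 2 p)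
        (AlgPoints.map (fiberι (cyclicCoverFamily p) t) Q')) : Q = Q' :=
  AlgPoints.map_fiberι_injective _ _ (eq_of_coords_eq_of_map_eq p h
    (by rw [AlgPoints.map_map_fiberι, AlgPoints.map_map_fiberι]))

/-- **Composition of scaled maps**: `fibreScale_{b} ∘ fibreScale_{a} = fibreScale_{b a}` (coordinates
`[b * (a * z)] = [(b a) * z]`). [cite: CarlsonToledo1999, §2 (held text p0004–p0005)] -/
theorem fibreScale_fibreScale {t₁ t₂ t₃ : ComplexPoints (cyclicCoverBase p)} {a b : Fin 4 → ℂ}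
    (ha : ∀ i, a i ≠ 0) (hb : ∀ i, b i ≠ 0)
    (ha' : ∀ ℓ ∈ Projectivization.projZeroLocus {pointFormSpz ℂ 2 p (cyclicCoverSpz p) t₁},
      scaleProj a ha ℓ ∈ Projectivization.projZeroLocus {pointFormSpz ℂ 2 p (cyclicCoverSpz p) t₂})
    (hb' : ∀ ℓ ∈ Projectivization.projZeroLocus {pointFormSpz ℂ 2 p (cyclicCoverSpz p) t₂},
      scaleProj b hb ℓ ∈ Projectivization.projZeroLocus {pointFormSpz ℂ 2 p (cyclicCoverSpz p) t₃})
    (hba : ∀ ℓ ∈ Projectivization.projZeroLocus {pointFormSpz ℂ 2 p (cyclicCoverSpz p) t₁},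
      scaleProj (b * a) (fun i => mul_ne_zero (hb i) (ha i)) ℓ ∈
        Projectivization.projZeroLocus {pointFormSpz ℂ 2 p (cyclicCoverSpz p) t₃})
    (Q : ComplexPoints (fiberOver (cyclicCoverFamily p) t₁)) :
    fibreScale t₂ t₃ b hb hb' (fibreScale t₁ t₂ a ha ha' Q) = fibreScale t₁ t₃ (b * a) _ hba Q := by
  apply eq_of_coords_map_fiberι_eq
  rw [coords_map_fiberι_fibreScale, coords_map_fiberι_fibreScale, coords_map_fiberι_fibreScale, scaleProj_scaleProj]

/-- **The scaled map with `a = 1` is the identity.** [cite: CarlsonToledo1999, §2 (held text p0004–p0005)] -/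
theorem fibreScale_one {t : ComplexPoints (cyclicCoverBase p)}
    (h1 : ∀ ℓ ∈ Projectivization.projZeroLocus {pointFormSpz ℂ 2 p (cyclicCoverSpz p) t},
      scaleProj 1 (fun _ => one_ne_zero) ℓ ∈ Projectivization.projZeroLocus {pointFormSpz ℂ 2 p (cyclicCoverSpz p) t})
    (Q : ComplexPoints (fiberOver (cyclicCoverFamily p) t)) :
    fibreScale t t 1 (fun _ => one_ne_zero) h1 Q = Q := by
  apply eq_of_coords_map_fiberι_eq
  rw [coords_map_fiberι_fibreScale, scaleProj_one]

/-- **Joint continuity of the isotopy**: for continuous `t(x)`, `a(x)`, the map `(x, Q) ↦ ι(fibreScale_{a(x)} Q)` into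
`𝒴(ℂ)` is continuous (the input `hcont` of `DirectImageIsotopy`). [cite: CarlsonToledo1999, §2 (held text p0004–p0005)] -/
theorem continuous_map_fiberι_fibreScale_family {A : Type*} [TopologicalSpace A] {t₁ : ComplexPoints (cyclicCoverBase p)}
    (t : A → ComplexPoints (cyclicCoverBase p)) (ht : Continuous t) (a : A → Fin 4 → ℂ) (ha : ∀ x i, a x i ≠ 0)
    (hac : Continuous a)
    (hland : ∀ x, ∀ ℓ ∈ Projectivization.projZeroLocus {pointFormSpz ℂ 2 p (cyclicCoverSpz p) t₁},
      scaleProj (a x) (ha x) ℓ ∈ Projectivization.projZeroLocus {pointFormSpz ℂ 2 p (cyclicCoverSpz p) (t x)}) :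
    Continuous fun q : ComplexPoints (fiberOver (cyclicCoverFamily p) t₁) × A =>
      AlgPoints.map (fiberι (cyclicCoverFamily p) (t q.2)) (fibreScale t₁ (t q.2) (a q.2) (ha q.2) (hland q.2) q.1) := by
  let ℓ : ComplexPoints (fiberOver (cyclicCoverFamily p) t₁) × A → ℙ ℂ (Fin 4 → ℂ) := fun q =>
    hypersurfacePoint (totalSpzToTotal ℂ 2 p (cyclicCoverSpz p) ≫ UniversalHypersurface.toProjectiveSpace ℂ 2 p)
      (AlgPoints.map (fiberι (cyclicCoverFamily p) t₁) q.1)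
  have hℓc : Continuous ℓ :=
    (continuous_hypersurfacePoint _).comp ((AlgPoints.continuous_map _).comp continuous_fst)
  have hkey := continuous_scaledTotalPoint (fun q : ComplexPoints (fiberOver (cyclicCoverFamily p) t₁) × A => t q.2)
    (ht.comp continuous_snd) (fun q => a q.2) (fun q => ha q.2) (hac.comp continuous_snd) ℓ hℓc
    (fun q => scaleProj_coords_mem (ha q.2) (hland q.2) q.1)
  refine hkey.congr fun q => ?_
  exact (map_fiberι_fibreScale (ha q.2) (hland q.2) q.1).symm

end Fibre

end Literature.AlgebraicGeometry.HodgeTheory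

end
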